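import Mathlib
import Summits.NavierStokesRegularity.NavierStokesRegularity.Theorems.LerayQuarterDissipationFiniteDissipationLiouvilleSmallDissipationGapCutoff
import Literature.Analysis.FluidPDE.SobolevWholeSpace
import HarnessLib

/-!
# Small-dissipation gap for the finite-dissipation stratum, file 2/3: the stretching term priced by
  the global `Ḣ¹` law of the similarity slice, and the localised similarity enstrophy budget
  (route `LerayQuarterDissipation`, crux `FiniteDissipationLiouville` stmt-NavierStokesRegularity-22144,
  BC5 rung `stub_smallDissipationGap`; `--supports` helper; seat ns-lqd-p2)

HONEST FRAMING. Label-free analysis helper about a HYPOTHETICAL object — a Type-I ancient mild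
solution in the Koch–Nadirashvili–Seregin–Šverák gauge (`IsTypeIAncientMild C V`) — under the
ADDITIONAL hypothesis that the similarity slices have uniformly square-integrable gradient
`∫ ‖DU(s)‖² ≤ K_U`. Nothing here bears on Navier–Stokes regularity or blow-up; no summit is proved.

CONTENTS. With `U = lerayOrbit V`, `Ω = lerayVorticity V = curl U`, the radial cutoff
`φ_R(y) = smoothTransition (2 − ‖y‖²/R²)` of crux `MustSqueeze` and the SQUARED weight `φ_R²`, the
tree's identity `signedBudget_enstrophy_identity` (valid for every `C_c^∞` weight) gives the budget of
`Z_R(s) = ∫ φ_R² ‖Ω(s)‖²`. The transport and viscous fluxes are priced by the collar mass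
`I = ∫_{B̄_{2R}} ‖Ω‖²` exactly as in `…SimilarityEnstrophyCutoffBudget`, with the squared-cutoff lemmas of file 1/3 (`…SmallDissipationGapCutoff`) (time-only Type-I bound
`‖U‖ ≤ C`); the NEW point is the stretching term: `2∫φ²⟪DU Ω, Ω⟫ = 2∫⟪DU(φΩ), φΩ⟫ ≤ 2‖DU‖_{L²}‖φΩ‖²_{L⁴}`
and Ladyzhenskaya's inequality `∫‖g‖⁴ ≤ K_S³ (∫‖g‖²)^{1/2} (∫‖Dg‖²)^{3/2}`
(`integral_norm_pow_four_le_of_integrable`) with Young `4ab³ ≤ a⁴ + 3b⁴` give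
`2∫φ²⟪DU Ω, Ω⟫ ≤ θ/2 · Z_R + 3θ ∫φ²‖∇Ω‖²_F + 3θ (c₁/R)² I`, `θ = √K_U · K_S^{3/2}`; for `θ ≤ 2/3`
the dissipation absorbs it and `Z_R' ≤ −(1/6) Z_R + (L/R) I` (`deriv_sqCutoffEnstrophy_le`).
File 3/3 feeds `K_U = K` from the quarter-rate dissipation law (scale invariance) and closes the rung.
[folklore energy method; Ladyzhenskaya 1969 (the `L⁴` inequality); Evans PDE §5.6.1]
-/

noncomputable section

set_option linter.dupNamespace false

namespace Summit.NavierStokesRegularity.NavierStokesRegularity.Theorems.SmallDissipationGap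

open MeasureTheory Set Filter Topology Metric InnerProductSpace Function Real
open scoped RealInnerProductSpace Laplacian ContDiff
open Literature.Analysis Literature.Analysis.FluidPDE
open Summit.NavierStokesRegularity.NavierStokesRegularity.Theorems
open Summit.NavierStokesRegularity.NavierStokesRegularity.Theorems.GaussianGap
open Summit.NavierStokesRegularity.NavierStokesRegularity.Theorems.SimilarityEnstrophy

variable {C : ℝ} {V : ℝ → (EuclideanSpace ℝ (Fin 3)) → (EuclideanSpace ℝ (Fin 3))}

/-! ### The stretching term priced by the global `Ḣ¹` bound of the similarity slice -/

section Stretching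

/-- Young's inequality `4ab³ ≤ a⁴ + 3b⁴` for `a, b ≥ 0` (`a⁴ + 3b⁴ − 4ab³ = (a − b)²(a² + 2ab + 3b²)`).
[folklore] -/
theorem four_mul_mul_cube_le {a b : ℝ} (ha : 0 ≤ a) (hb : 0 ≤ b) : 4 * (a * b ^ 3) ≤ a ^ 4 + 3 * b ^ 4 := by
  nlinarith [mul_nonneg (sq_nonneg (a - b)) (by positivity : (0:ℝ) ≤ a ^ 2 + 2 * a * b + 3 * b ^ 2),
    mul_nonneg ha hb]

/-- **The stretching term against the squared cutoff, priced by `‖DU(s)‖_{L²}`.** With `g = φ_R Ω`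
(compactly supported, `C¹`): `2∫φ_R²⟪DU Ω, Ω⟫ = 2∫⟪DU g, g⟫ ≤ 2‖DU‖_{L²} ‖g‖²_{L⁴}`, Ladyzhenskaya
`∫‖g‖⁴ ≤ K_S³ (∫‖g‖²)^{1/2}(∫‖Dg‖²)^{3/2}` (`integral_norm_pow_four_le_of_integrable`), Young
`4ab³ ≤ a⁴ + 3b⁴` and `‖Dg‖² ≤ 2φ_R²‖DΩ‖² + 2‖Dφ_R‖²‖Ω‖²` give, with `θ = √K_U · (√K_S)³`,
`2∫φ_R²⟪DU Ω, Ω⟫ ≤ (θ/2) Z_R + 3θ ∫φ_R²‖∇Ω‖²_F + 3θ (c₁/R)² ∫_{B̄_{2R}}‖Ω‖²`.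
[folklore; Ladyzhenskaya's inequality, Evans PDE §5.6.1] -/
theorem two_mul_integral_sqCutoff_stretching_le (hV : IsTypeIAncientMild C V) {c₁ : ℝ}
    (hc₁ : ∀ R : ℝ, 0 < R → ∀ y : (EuclideanSpace ℝ (Fin 3)),
      ‖fderiv ℝ (fun z : (EuclideanSpace ℝ (Fin 3)) => smoothTransition (2 - ‖z‖ ^ 2 / R ^ 2)) y‖ ≤ c₁ / R)
    {R : ℝ} (hR : 0 < R) (s : ℝ) {KU : ℝ}
    (hint : Integrable (fun y => ‖fderiv ℝ (lerayOrbit V s) y‖ ^ 2))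
    (hKU : ∫ y, ‖fderiv ℝ (lerayOrbit V s) y‖ ^ 2 ≤ KU) :
    2 * (∫ y, smoothTransition (2 - ‖y‖ ^ 2 / R ^ 2) ^ 2 *
        ⟪fderiv ℝ (lerayOrbit V s) y (lerayVorticity V s y), lerayVorticity V s y⟫) ≤
      (Real.sqrt KU * Real.sqrt (SNormLESNormFDerivOfEqConst (EuclideanSpace ℝ (Fin 3)) (volume : Measure (EuclideanSpace ℝ (Fin 3))) 2 : ℝ) ^ 3 / 2) *
          (∫ y, smoothTransition (2 - ‖y‖ ^ 2 / R ^ 2) ^ 2 * ‖lerayVorticity V s y‖ ^ 2) +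
        3 * (Real.sqrt KU * Real.sqrt (SNormLESNormFDerivOfEqConst (EuclideanSpace ℝ (Fin 3)) (volume : Measure (EuclideanSpace ℝ (Fin 3))) 2 : ℝ) ^ 3) *
          (∫ y, smoothTransition (2 - ‖y‖ ^ 2 / R ^ 2) ^ 2 *
            frobeniusNormSq (fderiv ℝ (lerayVorticity V s) y)) +
        3 * (Real.sqrt KU * Real.sqrt (SNormLESNormFDerivOfEqConst (EuclideanSpace ℝ (Fin 3)) (volume : Measure (EuclideanSpace ℝ (Fin 3))) 2 : ℝ) ^ 3) *
          (c₁ / R) ^ 2 * ∫ y in closedBall (0 : (EuclideanSpace ℝ (Fin 3))) (2 * R), ‖lerayVorticity V s y‖ ^ 2 := by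
  set KS : ℝ := (SNormLESNormFDerivOfEqConst (EuclideanSpace ℝ (Fin 3)) (volume : Measure (EuclideanSpace ℝ (Fin 3))) 2 : ℝ) with hKSdef
  have hKS0 : 0 ≤ KS := NNReal.coe_nonneg _
  set φ : (EuclideanSpace ℝ (Fin 3)) → ℝ := fun z => smoothTransition (2 - ‖z‖ ^ 2 / R ^ 2) with hφdef
  set Ω := lerayVorticity V s with hΩdef
  set U := lerayOrbit V s with hUdef
  have hφ1 : ContDiff ℝ 1 φ := contDiff_smoothTransition_cutoff (n := 1) R
  have hφ0 : ∀ y, 0 ≤ φ y := fun y => smoothTransition_cutoff_nonneg R y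
  have hφz : ∀ y ∉ closedBall (0 : (EuclideanSpace ℝ (Fin 3))) (2 * R), φ y = 0 := fun y hy =>
    smoothTransition_cutoff_eq_zero_of_notMem hR hy
  have hφ2c : HasCompactSupport fun y : (EuclideanSpace ℝ (Fin 3)) => φ y ^ 2 := hasCompactSupport_sqCutoff hR
  have hΩ1 : ContDiff ℝ 1 Ω := signedBudget_contDiff_lerayVorticity_slice hV s (n := 1)
  have hU1 : ContDiff ℝ 1 U := mustSqueeze_contDiff_lerayOrbit_slice hV s (n := 1)
  have hcΩ : Continuous Ω := hΩ1.continuous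
  have hcDΩ : Continuous (fderiv ℝ Ω) := hΩ1.continuous_fderiv one_ne_zero
  have hcDU : Continuous (fderiv ℝ U) := hU1.continuous_fderiv one_ne_zero
  have hcφ : Continuous φ := hφ1.continuous
  have hcDφ : Continuous (fderiv ℝ φ) := hφ1.continuous_fderiv one_ne_zero
  have hcF : Continuous fun y => frobeniusNormSq (fderiv ℝ Ω y) :=
    continuous_frobeniusNormSq_fderiv_lerayVorticity hV s
  have add_sq : ∀ p q : ℝ, (p + q) ^ 2 ≤ 2 * p ^ 2 + 2 * q ^ 2 := fun p q => by
    nlinarith [sq_nonneg (p - q)]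
  -- the test field `g = φ Ω`
  have hg1 : ContDiff ℝ 1 fun y => φ y • Ω y := hφ1.smul hΩ1
  have hcg : Continuous fun y => φ y • Ω y := hg1.continuous
  have hcDg : Continuous (fderiv ℝ fun y => φ y • Ω y) := hg1.continuous_fderiv one_ne_zero
  have hg0 : ∀ y ∉ closedBall (0 : (EuclideanSpace ℝ (Fin 3))) (2 * R), φ y • Ω y = 0 := fun y hy => by
    rw [hφz y hy, zero_smul]
  have hgts : tsupport (fun y => φ y • Ω y) ⊆ closedBall (0 : (EuclideanSpace ℝ (Fin 3))) (2 * R) :=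
    closure_minimal (fun y hy => by by_contra h; exact hy (hg0 y h)) isClosed_closedBall
  have hDg0 : ∀ y ∉ closedBall (0 : (EuclideanSpace ℝ (Fin 3))) (2 * R), fderiv ℝ (fun y => φ y • Ω y) y = 0 := fun y hy =>
    fderiv_of_notMem_tsupport ℝ fun h => hy (hgts h)
  have hcs : ∀ {f : (EuclideanSpace ℝ (Fin 3)) → ℝ}, (∀ y ∉ closedBall (0 : (EuclideanSpace ℝ (Fin 3))) (2 * R), f y = 0) → HasCompactSupport f :=
    fun hf => HasCompactSupport.intro (isCompact_closedBall (0 : (EuclideanSpace ℝ (Fin 3))) (2 * R)) hf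
  have hs2 : HasCompactSupport fun y => ‖φ y • Ω y‖ ^ 2 :=
    hcs fun y hy => by show ‖φ y • Ω y‖ ^ 2 = 0; rw [hg0 y hy]; simp
  have hs6 : HasCompactSupport fun y => ‖φ y • Ω y‖ ^ 6 :=
    hcs fun y hy => by show ‖φ y • Ω y‖ ^ 6 = 0; rw [hg0 y hy]; simp
  have hsB : HasCompactSupport fun y => ‖fderiv ℝ (fun y => φ y • Ω y) y‖ ^ 2 :=
    hcs fun y hy => by show ‖fderiv ℝ (fun y => φ y • Ω y) y‖ ^ 2 = 0; rw [hDg0 y hy]; simp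
  have hi2 : Integrable fun y => ‖φ y • Ω y‖ ^ 2 := (hcg.norm.pow 2).integrable_of_hasCompactSupport hs2
  have hi6 : Integrable fun y => ‖φ y • Ω y‖ ^ 6 := (hcg.norm.pow 6).integrable_of_hasCompactSupport hs6
  have hiB : Integrable fun y => ‖fderiv ℝ (fun y => φ y • Ω y) y‖ ^ 2 :=
    (hcDg.norm.pow 2).integrable_of_hasCompactSupport hsB
  -- (1) Ladyzhenskaya
  have hL := integral_norm_pow_four_le_of_integrable (volume : Measure (EuclideanSpace ℝ (Fin 3))) finrank_euclideanSpace_fin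
    hg1 hi2 hi6 hiB
  rw [← hKSdef] at hL
  set A : ℝ := ∫ y, ‖φ y • Ω y‖ ^ 2 with hAdef
  set B : ℝ := ∫ y, ‖fderiv ℝ (fun y => φ y • Ω y) y‖ ^ 2 with hBdef
  set I4 : ℝ := ∫ y, ‖φ y • Ω y‖ ^ 4 with hI4def
  set Z : ℝ := ∫ y, φ y ^ 2 * ‖Ω y‖ ^ 2 with hZdef
  set D : ℝ := ∫ y, φ y ^ 2 * frobeniusNormSq (fderiv ℝ Ω y) with hDdef
  set I : ℝ := ∫ y in closedBall (0 : (EuclideanSpace ℝ (Fin 3))) (2 * R), ‖Ω y‖ ^ 2 with hIdef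
  set J : ℝ := ∫ y, ‖fderiv ℝ U y‖ ^ 2 with hJdef
  have hA0 : 0 ≤ A := integral_nonneg fun y => by positivity
  have hB0 : 0 ≤ B := integral_nonneg fun y => by positivity
  have hI0 : 0 ≤ I := integral_nonneg fun y => by positivity
  have hD0 : 0 ≤ D := integral_nonneg fun y => mul_nonneg (sq_nonneg _) (frobeniusNormSq_nonneg _)
  have hJ0 : 0 ≤ J := integral_nonneg fun y => by positivity
  have hKU0 : 0 ≤ KU := hJ0.trans hKU
  have hA12 : A ^ (1 / 2 : ℝ) = Real.sqrt A := by rw [Real.sqrt_eq_rpow]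
  have hB32 : B ^ (3 / 2 : ℝ) = Real.sqrt B ^ 3 := by
    rw [Real.sqrt_eq_rpow, ← Real.rpow_natCast, ← Real.rpow_mul hB0]; norm_num
  rw [hA12, hB32] at hL
  -- `A = Z` (`‖φ Ω‖² = φ² ‖Ω‖²`)
  have hAZ : A = Z := integral_congr_ae (Eventually.of_forall fun y => by
    show ‖φ y • Ω y‖ ^ 2 = φ y ^ 2 * ‖Ω y‖ ^ 2
    rw [norm_smul, Real.norm_of_nonneg (hφ0 y), mul_pow])
  -- (2) fourth roots: `√I4 ≤ k³ a b³`
  set k := Real.sqrt KS with hk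
  set a := Real.sqrt (Real.sqrt A) with ha
  set b := Real.sqrt (Real.sqrt B) with hb
  have hk0 : 0 ≤ k := Real.sqrt_nonneg _
  have ha0 : 0 ≤ a := Real.sqrt_nonneg _
  have hb0 : 0 ≤ b := Real.sqrt_nonneg _
  have hkK : k ^ 2 = KS := Real.sq_sqrt hKS0
  have hsA : a ^ 2 = Real.sqrt A := Real.sq_sqrt (Real.sqrt_nonneg A)
  have hsB : b ^ 2 = Real.sqrt B := Real.sq_sqrt (Real.sqrt_nonneg B)
  have hAa : A = a ^ 4 := by rw [show a ^ 4 = (a ^ 2) ^ 2 by ring, hsA, Real.sq_sqrt hA0]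
  have hBb : B = b ^ 4 := by rw [show b ^ 4 = (b ^ 2) ^ 2 by ring, hsB, Real.sq_sqrt hB0]
  have hs4 : Real.sqrt I4 ≤ k ^ 3 * a * b ^ 3 := by
    have h : I4 ≤ (k ^ 3 * a * b ^ 3) ^ 2 := by
      calc I4 ≤ KS ^ 3 * Real.sqrt A * Real.sqrt B ^ 3 := hL
        _ = (k ^ 3 * a * b ^ 3) ^ 2 := by rw [← hkK, ← hsA, ← hsB]; ring
    have := Real.sqrt_le_sqrt h
    rwa [Real.sqrt_sq (by positivity)] at this
  -- (3) Cauchy–Schwarz: `∫ ‖DU‖ ‖g‖² ≤ √J √I4`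
  have hmem1 : MemLp (fun y => ‖fderiv ℝ U y‖) (ENNReal.ofReal 2) volume := by
    rw [ENNReal.ofReal_ofNat]
    refine (memLp_two_iff_integrable_sq_norm hcDU.norm.aestronglyMeasurable).2 ?_
    exact hint.congr (Eventually.of_forall fun y => by simp only [norm_norm])
  have hmem2 : MemLp (fun y => ‖φ y • Ω y‖ ^ 2) (ENNReal.ofReal 2) volume := by
    rw [ENNReal.ofReal_ofNat]
    exact (hcg.norm.pow 2).memLp_of_hasCompactSupport hs2
  have hCS : ∫ y, ‖fderiv ℝ U y‖ * ‖φ y • Ω y‖ ^ 2 ≤ Real.sqrt J * Real.sqrt I4 := by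
    have h := integral_mul_norm_le_Lp_mul_Lq Real.HolderConjugate.two_two hmem1 hmem2
    have e0 : ∫ y, ‖‖fderiv ℝ U y‖‖ * ‖‖φ y • Ω y‖ ^ 2‖ = ∫ y, ‖fderiv ℝ U y‖ * ‖φ y • Ω y‖ ^ 2 :=
      integral_congr_ae (Eventually.of_forall fun y => by
        show ‖‖fderiv ℝ U y‖‖ * ‖‖φ y • Ω y‖ ^ 2‖ = ‖fderiv ℝ U y‖ * ‖φ y • Ω y‖ ^ 2
        rw [norm_norm, norm_pow, norm_norm])
    have e1 : ∫ y, ‖‖fderiv ℝ U y‖‖ ^ (2 : ℝ) = J := integral_congr_ae (Eventually.of_forall fun y => by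
      show ‖‖fderiv ℝ U y‖‖ ^ (2 : ℝ) = ‖fderiv ℝ U y‖ ^ 2
      rw [norm_norm, Real.rpow_two])
    have e2 : ∫ y, ‖‖φ y • Ω y‖ ^ 2‖ ^ (2 : ℝ) = I4 := integral_congr_ae (Eventually.of_forall fun y => by
      show ‖‖φ y • Ω y‖ ^ 2‖ ^ (2 : ℝ) = ‖φ y • Ω y‖ ^ 4
      rw [norm_pow, norm_norm, Real.rpow_two]; ring)
    rw [e0, e1, e2, ← Real.sqrt_eq_rpow, ← Real.sqrt_eq_rpow] at h
    exact h
  -- (4) the stretching integrand against `‖DU‖ ‖g‖²`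
  have hpt : ∀ y, φ y ^ 2 * ⟪fderiv ℝ U y (Ω y), Ω y⟫ ≤ ‖fderiv ℝ U y‖ * ‖φ y • Ω y‖ ^ 2 := by
    intro y
    have e : φ y ^ 2 * ⟪fderiv ℝ U y (Ω y), Ω y⟫ = ⟪fderiv ℝ U y (φ y • Ω y), φ y • Ω y⟫ := by
      rw [map_smul, real_inner_smul_left, real_inner_smul_right]; ring
    rw [e]
    calc ⟪fderiv ℝ U y (φ y • Ω y), φ y • Ω y⟫ ≤ ‖fderiv ℝ U y (φ y • Ω y)‖ * ‖φ y • Ω y‖ :=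
          real_inner_le_norm _ _
      _ ≤ ‖fderiv ℝ U y‖ * ‖φ y • Ω y‖ * ‖φ y • Ω y‖ :=
          mul_le_mul_of_nonneg_right (ContinuousLinearMap.le_opNorm _ _) (norm_nonneg _)
      _ = ‖fderiv ℝ U y‖ * ‖φ y • Ω y‖ ^ 2 := by ring
  have iS : Integrable fun y => φ y ^ 2 * ⟪fderiv ℝ U y (Ω y), Ω y⟫ :=
    ((hcφ.pow 2).mul ((hcDU.clm_apply hcΩ).inner hcΩ)).integrable_of_hasCompactSupport hφ2c.mul_right
  have iP : Integrable fun y => ‖fderiv ℝ U y‖ * ‖φ y • Ω y‖ ^ 2 :=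
    (hcDU.norm.mul (hcg.norm.pow 2)).integrable_of_hasCompactSupport
      (hcs fun y hy => by show ‖fderiv ℝ U y‖ * ‖φ y • Ω y‖ ^ 2 = 0; rw [hg0 y hy]; simp)
  have hS : (∫ y, φ y ^ 2 * ⟪fderiv ℝ U y (Ω y), Ω y⟫) ≤ Real.sqrt J * Real.sqrt I4 :=
    (integral_mono iS iP hpt).trans hCS
  -- (5) `B ≤ 2 D + 2 (c₁/R)² I`
  have hDg : ∀ y, ‖fderiv ℝ (fun y => φ y • Ω y) y‖ ^ 2 ≤ 2 * (φ y ^ 2 * frobeniusNormSq (fderiv ℝ Ω y)) +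
      2 * (‖fderiv ℝ φ y‖ ^ 2 * ‖Ω y‖ ^ 2) := by
    intro y
    have hdφ : DifferentiableAt ℝ φ y := hφ1.differentiable one_ne_zero y
    have hdΩ : DifferentiableAt ℝ Ω y := hΩ1.differentiable one_ne_zero y
    have e : fderiv ℝ (fun y => φ y • Ω y) y = φ y • fderiv ℝ Ω y + (fderiv ℝ φ y).smulRight (Ω y) :=
      (hdφ.hasFDerivAt.smul hdΩ.hasFDerivAt).fderiv
    have hn : ‖fderiv ℝ (fun y => φ y • Ω y) y‖ ≤ φ y * ‖fderiv ℝ Ω y‖ + ‖fderiv ℝ φ y‖ * ‖Ω y‖ := by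
      rw [e]
      refine (norm_add_le _ _).trans (add_le_add ?_ ?_)
      · rw [norm_smul, Real.norm_of_nonneg (hφ0 y)]
      · exact (ContinuousLinearMap.norm_smulRight_apply _ _).le
    have hop : ‖fderiv ℝ Ω y‖ ^ 2 ≤ frobeniusNormSq (fderiv ℝ Ω y) := sq_opNorm_le_frobeniusNormSq _
    have hop' : φ y ^ 2 * ‖fderiv ℝ Ω y‖ ^ 2 ≤ φ y ^ 2 * frobeniusNormSq (fderiv ℝ Ω y) :=
      mul_le_mul_of_nonneg_left hop (sq_nonneg _)
    calc ‖fderiv ℝ (fun y => φ y • Ω y) y‖ ^ 2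
        ≤ (φ y * ‖fderiv ℝ Ω y‖ + ‖fderiv ℝ φ y‖ * ‖Ω y‖) ^ 2 :=
          pow_le_pow_left₀ (norm_nonneg _) hn 2
      _ ≤ 2 * (φ y * ‖fderiv ℝ Ω y‖) ^ 2 + 2 * (‖fderiv ℝ φ y‖ * ‖Ω y‖) ^ 2 := add_sq _ _
      _ = 2 * (φ y ^ 2 * ‖fderiv ℝ Ω y‖ ^ 2) + 2 * (‖fderiv ℝ φ y‖ ^ 2 * ‖Ω y‖ ^ 2) := by ring
      _ ≤ 2 * (φ y ^ 2 * frobeniusNormSq (fderiv ℝ Ω y)) + 2 * (‖fderiv ℝ φ y‖ ^ 2 * ‖Ω y‖ ^ 2) := by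
          linarith [hop']
  have iD : Integrable fun y => φ y ^ 2 * frobeniusNormSq (fderiv ℝ Ω y) :=
    ((hcφ.pow 2).mul hcF).integrable_of_hasCompactSupport hφ2c.mul_right
  have hDφ0 : ∀ y ∉ closedBall (0 : (EuclideanSpace ℝ (Fin 3))) (2 * R), ‖fderiv ℝ φ y‖ ^ 2 = 0 := fun y hy => by
    rw [hφdef, signedBudget_fderiv_cutoff_eq_zero hR hy, norm_zero]; ring
  have iC : Integrable fun y => ‖fderiv ℝ φ y‖ ^ 2 * ‖Ω y‖ ^ 2 :=
    ((hcDφ.norm.pow 2).mul (hcΩ.norm.pow 2)).integrable_of_hasCompactSupport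
      (hcs fun y hy => by show ‖fderiv ℝ φ y‖ ^ 2 * ‖Ω y‖ ^ 2 = 0; rw [hDφ0 y hy, zero_mul])
  have hcollar : (∫ y, ‖fderiv ℝ φ y‖ ^ 2 * ‖Ω y‖ ^ 2) ≤ (c₁ / R) ^ 2 * I := by
    refine (le_abs_self _).trans (abs_integral_le_of_weight_sq hcΩ (w := fun y => ‖fderiv ℝ φ y‖ ^ 2)
      (hcDφ.norm.pow 2) hDφ0 (fun y _ => ?_) (fun y => ?_))
    · exact pow_le_pow_left₀ (norm_nonneg _) (hc₁ R hR y) 2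
    · rw [abs_of_nonneg (by positivity)]
  have hB : B ≤ 2 * D + 2 * ((c₁ / R) ^ 2 * I) := by
    calc B ≤ ∫ y, (2 * (φ y ^ 2 * frobeniusNormSq (fderiv ℝ Ω y)) +
          2 * (‖fderiv ℝ φ y‖ ^ 2 * ‖Ω y‖ ^ 2)) :=
          integral_mono hiB ((iD.const_mul 2).add (iC.const_mul 2)) hDg
      _ = 2 * D + 2 * ∫ y, ‖fderiv ℝ φ y‖ ^ 2 * ‖Ω y‖ ^ 2 := by
          rw [integral_add (iD.const_mul 2) (iC.const_mul 2), integral_const_mul, integral_const_mul]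
      _ ≤ 2 * D + 2 * ((c₁ / R) ^ 2 * I) := by linarith [hcollar]
  -- (6) assemble with Young `4ab³ ≤ a⁴ + 3b⁴`
  have hJK : Real.sqrt J ≤ Real.sqrt KU := Real.sqrt_le_sqrt hKU
  have hY : 4 * (a * b ^ 3) ≤ a ^ 4 + 3 * b ^ 4 := four_mul_mul_cube_le ha0 hb0
  have hI40 : 0 ≤ Real.sqrt I4 := Real.sqrt_nonneg _
  have hθ0 : 0 ≤ Real.sqrt KU * k ^ 3 := by positivity
  have hmain : 2 * (Real.sqrt J * Real.sqrt I4) ≤ (Real.sqrt KU * k ^ 3 / 2) * (A + 3 * B) := by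
    calc 2 * (Real.sqrt J * Real.sqrt I4) ≤ 2 * (Real.sqrt KU * (k ^ 3 * a * b ^ 3)) := by
          gcongr
      _ = (Real.sqrt KU * k ^ 3 / 2) * (4 * (a * b ^ 3)) := by ring
      _ ≤ (Real.sqrt KU * k ^ 3 / 2) * (a ^ 4 + 3 * b ^ 4) :=
          mul_le_mul_of_nonneg_left hY (by positivity)
      _ = (Real.sqrt KU * k ^ 3 / 2) * (A + 3 * B) := by rw [hAa, hBb]
  have hBθ := mul_le_mul_of_nonneg_left hB hθ0
  rw [← hAZ]
  linarith [hS, hmain, hBθ]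

end Stretching

/-! ### The budget -/

section Budget

/-- **The localised similarity-enstrophy inequality with small dissipation.** Let `V` be a KNSS-gauge
Type-I field with constant `C` whose similarity slices have uniformly square-integrable gradient,
`∫ ‖DU(s)‖² ≤ K_U` for all `s`, with `√K_U · (√K_S)³ ≤ 2/3` (`K_S` Mathlib's Sobolev constant of
`Ḣ¹(ℝ³) ⊂ L⁶`). Then there is `L ≥ 0` such that for every `R ≥ 1` and every `s` the squared-cutoff
enstrophy `Z_R(s) = ∫ φ_R² ‖Ω(s)‖²` satisfies `Z_R'(s) ≤ −(1/6) Z_R(s) + (L/R) ∫_{B̄_{2R}} ‖Ω(s)‖²`: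
the identity `deriv_sqCutoffEnstrophy_eq`, the signed drift flux, the collar bounds for `D(φ_R²)` and
`Δ(φ_R²)`, and the stretching bound `two_mul_integral_sqCutoff_stretching_le` absorbed into the
dissipation and the damping. [folklore energy method] -/
theorem deriv_sqCutoffEnstrophy_le (hV : IsTypeIAncientMild C V) {KU : ℝ}
    (hint : ∀ s : ℝ, Integrable (fun y => ‖fderiv ℝ (lerayOrbit V s) y‖ ^ 2))
    (hKU : ∀ s : ℝ, ∫ y, ‖fderiv ℝ (lerayOrbit V s) y‖ ^ 2 ≤ KU)
    (hθ : Real.sqrt KU * Real.sqrt (SNormLESNormFDerivOfEqConst (EuclideanSpace ℝ (Fin 3)) (volume : Measure (EuclideanSpace ℝ (Fin 3))) 2 : ℝ) ^ 3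
      ≤ 2 / 3) :
    ∃ L : ℝ, 0 ≤ L ∧ ∀ R : ℝ, 1 ≤ R → ∀ s : ℝ,
      deriv (fun σ => ∫ y, smoothTransition (2 - ‖y‖ ^ 2 / R ^ 2) ^ 2 * ‖lerayVorticity V σ y‖ ^ 2) s ≤
        -(1 / 6) * (∫ y, smoothTransition (2 - ‖y‖ ^ 2 / R ^ 2) ^ 2 * ‖lerayVorticity V s y‖ ^ 2) +
          L / R * ∫ y in closedBall (0 : (EuclideanSpace ℝ (Fin 3))) (2 * R), ‖lerayVorticity V s y‖ ^ 2 := by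
  obtain ⟨c₁, hc₁0, hc₁⟩ :=
    exists_norm_fderiv_smoothTransition_cutoff_le (E := (EuclideanSpace ℝ (Fin 3)))
  obtain ⟨c₂, hc₂0, hc₂⟩ :=
    exists_abs_laplacian_smoothTransition_cutoff_le (E := (EuclideanSpace ℝ (Fin 3)))
  have hC : 0 ≤ C := hV.nonneg
  refine ⟨2 * C * c₁ + 2 * c₂ + 8 * c₁ ^ 2, by positivity, fun R hR1 s => ?_⟩
  have hR : 0 < R := lt_of_lt_of_le one_pos hR1
  rw [deriv_sqCutoffEnstrophy_eq hV hR s]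
  set θ : ℝ := Real.sqrt KU * Real.sqrt (SNormLESNormFDerivOfEqConst (EuclideanSpace ℝ (Fin 3)) (volume : Measure (EuclideanSpace ℝ (Fin 3))) 2 : ℝ) ^ 3
    with hθdef
  have hθ0 : 0 ≤ θ := by positivity
  set φ : (EuclideanSpace ℝ (Fin 3)) → ℝ := fun z => smoothTransition (2 - ‖z‖ ^ 2 / R ^ 2) with hφdef
  set Ω := lerayVorticity V s with hΩdef
  set U := lerayOrbit V s with hUdef
  set I : ℝ := ∫ y in closedBall (0 : (EuclideanSpace ℝ (Fin 3))) (2 * R), ‖Ω y‖ ^ 2 with hIdef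
  set Z : ℝ := ∫ y, φ y ^ 2 * ‖Ω y‖ ^ 2 with hZdef
  set D : ℝ := ∫ y, φ y ^ 2 * frobeniusNormSq (fderiv ℝ Ω y) with hDdef
  have hI0 : 0 ≤ I := integral_nonneg fun y => sq_nonneg _
  have hZ0 : 0 ≤ Z := integral_nonneg fun y => mul_nonneg (sq_nonneg _) (sq_nonneg _)
  have hD0 : 0 ≤ D := integral_nonneg fun y => mul_nonneg (sq_nonneg _) (frobeniusNormSq_nonneg _)
  have hΩ1 : ContDiff ℝ 1 Ω := signedBudget_contDiff_lerayVorticity_slice hV s (n := 1)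
  have hcΩ : Continuous Ω := hΩ1.continuous
  have hUC : ∀ y, ‖U y‖ ≤ C := fun y => norm_lerayOrbit_le_of_typeI hV s y
  have hw1 : ContDiff ℝ 1 fun z : (EuclideanSpace ℝ (Fin 3)) => φ z ^ 2 := contDiff_sqCutoff (n := 1) R
  have hw2 : ContDiff ℝ 2 fun z : (EuclideanSpace ℝ (Fin 3)) => φ z ^ 2 := contDiff_sqCutoff (n := 2) R
  have hcDw : Continuous (fderiv ℝ fun z : (EuclideanSpace ℝ (Fin 3)) => φ z ^ 2) := hw1.continuous_fderiv one_ne_zero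
  -- (1) drift flux `≤ 0`
  have hDrift : (∫ y, fderiv ℝ (fun z : (EuclideanSpace ℝ (Fin 3)) => φ z ^ 2) y y * ‖Ω y‖ ^ 2) ≤ 0 :=
    integral_nonpos fun y => mul_nonpos_iff.2 (Or.inr ⟨fderiv_sqCutoff_self_nonpos R y, sq_nonneg _⟩)
  -- (2) transport flux
  have hT : |∫ y, fderiv ℝ (fun z : (EuclideanSpace ℝ (Fin 3)) => φ z ^ 2) y (U y) * ‖Ω y‖ ^ 2| ≤ C * (2 * (c₁ / R)) * I := by
    refine abs_integral_le_of_weight_sq hcΩ (w := fun y => C * ‖fderiv ℝ (fun z : (EuclideanSpace ℝ (Fin 3)) => φ z ^ 2) y‖)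
      (continuous_const.mul hcDw.norm) (fun y hy => ?_) (fun y _ => ?_) (fun y => ?_)
    · show C * ‖fderiv ℝ (fun z : (EuclideanSpace ℝ (Fin 3)) => φ z ^ 2) y‖ = 0
      rw [hφdef, fderiv_sqCutoff_eq_zero hR hy, norm_zero, mul_zero]
    · exact mul_le_mul_of_nonneg_left (norm_fderiv_sqCutoff_le hc₁ hR y) hC
    · rw [abs_mul, abs_of_nonneg (sq_nonneg ‖Ω y‖)]
      have e1 : |fderiv ℝ (fun z : (EuclideanSpace ℝ (Fin 3)) => φ z ^ 2) y (U y)| ≤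
          ‖fderiv ℝ (fun z : (EuclideanSpace ℝ (Fin 3)) => φ z ^ 2) y‖ * C := by
        rw [← Real.norm_eq_abs]
        exact (ContinuousLinearMap.le_opNorm _ _).trans
          (mul_le_mul_of_nonneg_left (hUC y) (norm_nonneg _))
      calc |fderiv ℝ (fun z : (EuclideanSpace ℝ (Fin 3)) => φ z ^ 2) y (U y)| * ‖Ω y‖ ^ 2
          ≤ (‖fderiv ℝ (fun z : (EuclideanSpace ℝ (Fin 3)) => φ z ^ 2) y‖ * C) * ‖Ω y‖ ^ 2 :=
            mul_le_mul_of_nonneg_right e1 (sq_nonneg _)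
        _ = C * ‖fderiv ℝ (fun z : (EuclideanSpace ℝ (Fin 3)) => φ z ^ 2) y‖ * ‖Ω y‖ ^ 2 := by ring
  -- (3) viscous flux
  have hVisc : |∫ y, ‖Ω y‖ ^ 2 * (Δ (fun z : (EuclideanSpace ℝ (Fin 3)) => φ z ^ 2)) y| ≤
      (2 * (c₂ / R ^ 2) + 6 * (c₁ / R) ^ 2) * I := by
    refine abs_integral_le_of_weight_sq hcΩ (w := fun y => |(Δ (fun z : (EuclideanSpace ℝ (Fin 3)) => φ z ^ 2)) y|)
      (continuous_laplacian hw2).abs (fun y hy => ?_) (fun y _ => ?_) (fun y => ?_)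
    · show |(Δ (fun z : (EuclideanSpace ℝ (Fin 3)) => φ z ^ 2)) y| = 0
      rw [hφdef, laplacian_sqCutoff_eq_zero hR hy, abs_zero]
    · exact abs_laplacian_sqCutoff_le hc₁ hc₂ hR y
    · rw [abs_mul, abs_of_nonneg (sq_nonneg ‖Ω y‖), mul_comm]
  -- (4) stretching
  have hS := two_mul_integral_sqCutoff_stretching_le hV hc₁ hR s (hint s) (hKU s)
  rw [← hθdef] at hS
  -- absorption
  have hT' := (le_abs_self _).trans hT
  have hVisc' := (le_abs_self _).trans hVisc
  have hR2 : 1 / R ^ 2 ≤ 1 / R := by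
    rw [div_le_div_iff₀ (by positivity) hR]
    nlinarith
  have hc₂R : c₂ / R ^ 2 ≤ c₂ / R := by
    have := mul_le_mul_of_nonneg_left hR2 hc₂0
    simpa only [mul_one_div] using this
  have hc₁R : (c₁ / R) ^ 2 ≤ c₁ ^ 2 / R := by
    rw [div_pow]
    have := mul_le_mul_of_nonneg_left hR2 (sq_nonneg c₁)
    simpa only [mul_one_div] using this
  have a1 : θ / 2 * Z ≤ 1 / 3 * Z := mul_le_mul_of_nonneg_right (by linarith) hZ0
  have a2 : 3 * θ * D ≤ 2 * D := mul_le_mul_of_nonneg_right (by linarith) hD0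
  have a3 : 3 * θ * (c₁ / R) ^ 2 * I ≤ 2 * (c₁ ^ 2 / R) * I := by
    have h1 : 3 * θ * (c₁ / R) ^ 2 ≤ 2 * (c₁ / R) ^ 2 :=
      mul_le_mul_of_nonneg_right (by linarith) (sq_nonneg _)
    have h2 : 2 * (c₁ / R) ^ 2 ≤ 2 * (c₁ ^ 2 / R) := by linarith [hc₁R]
    exact mul_le_mul_of_nonneg_right (h1.trans h2) hI0
  have a4 : (2 * (c₂ / R ^ 2) + 6 * (c₁ / R) ^ 2) * I ≤ (2 * (c₂ / R) + 6 * (c₁ ^ 2 / R)) * I :=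
    mul_le_mul_of_nonneg_right (by linarith [hc₂R, hc₁R]) hI0
  have e : (2 * C * c₁ + 2 * c₂ + 8 * c₁ ^ 2) / R * I =
      C * (2 * (c₁ / R)) * I + (2 * (c₂ / R) + 6 * (c₁ ^ 2 / R)) * I + 2 * (c₁ ^ 2 / R) * I := by
    field_simp
    ring
  rw [e]
  linarith [hDrift, hT', hVisc', hS, a1, a2, a3, a4]

end Budget

end Summit.NavierStokesRegularity.NavierStokesRegularity.Theorems.SmallDissipationGap

end
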